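import Summits.Ventures.PercRepro.RLSRuleTriangleFree
import Summits.Ventures.PercRepro.RLSRuleKFourDemand

/-!
# C-025 at q = 3: the triangle plane — the demands (night-3, gen 4)

`≤ 39` at `t = 0` (every rank-`3` subset), `≤ 38` at `t = 1`, `≤ 32` at `t = 2`, `≤ 14` at `t = 3` (an independent
triple with an independent complement: the three complements of lines are excluded).
Imports `RLSRuleTriangleFree`, `RLSRuleKFourDemand` (the `6`-set counts `card_filter_four_le_one / two`).
Axioms: standard.
-/

open scoped Matroid

namespace PercRepro

namespace NightThree

open Finset ThmH PerFlat

variable {α : Type*} [DecidableEq α] {M : Matroid α} [M.Finite]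

open scoped Classical in
omit [M.Finite] in
/-- `#{independent triples of a triangle plane} = 17`. -/
theorem card_indep_triples_triangle {G : Finset α} {L : Finset (Finset α)} (h : Triangle M G L) :
    ((G.powersetCard 3).filter (fun T => T ∉ L)).card = 17 := by
  obtain ⟨hGc, hLc, hL, hdeg, hdeg2, hind⟩ := h
  have hsubL : L ⊆ G.powersetCard 3 := fun ℓ hℓ => Finset.mem_powersetCard.2 ⟨(hL ℓ hℓ).1, (hL ℓ hℓ).2.1⟩
  have := Finset.card_filter_add_card_filter_not (s := G.powersetCard 3) (fun T => T ∉ L)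
  have hL' : (G.powersetCard 3).filter (fun T => ¬ T ∉ L) = L := by
    ext T; simp only [Finset.mem_filter, not_not]; exact ⟨fun h => h.2, fun h => ⟨hsubL h, h⟩⟩
  rw [hL', hLc, Finset.card_powersetCard, hGc, show Nat.choose 6 3 = 20 by norm_num [Nat.choose]] at this
  omega

open scoped Classical in
/-- The bottom sets of a triangle plane are rank-`3` subsets: at most `39` of them. -/
theorem card_UqG_le_triangle_t0 {G : Finset α} {L : Finset (Finset α)} {p : ℕ} (h : Triangle M G L) :
    (UqG M p 3 G).card ≤ 39 := by
  have h' := h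
  obtain ⟨hGc, hLc, hL, hdeg, hdeg2, hind⟩ := h
  have hsub : UqG M p 3 G ⊆ (G.powersetCard 3).filter (fun T => T ∉ L) ∪ G.powersetCard 4 ∪ G.powersetCard 5 ∪ {G} := by
    intro B hB
    have hB' := hB
    unfold UqG at hB'
    rw [Finset.mem_filter, mem_Uq] at hB'
    obtain ⟨⟨_, hB3, _⟩, hBG⟩ := hB'
    have hB3' : M.eRk (B : Set α) = 3 := by exact_mod_cast hB3
    have hBc := three_le_card_of_eRk_eq_three hB3'
    have hB6 : B.card ≤ 6 := by rw [← hGc]; exact Finset.card_le_card hBG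
    simp only [Finset.mem_union, Finset.mem_filter, Finset.mem_powersetCard, Finset.mem_singleton]
    rcases (show B.card = 3 ∨ B.card = 4 ∨ B.card = 5 ∨ B.card = 6 by omega) with h3 | h4 | h5 | h6
    · left; left; left
      refine ⟨⟨hBG, h3⟩, ?_⟩
      intro hBL
      have := (hL B hBL).2.2
      rw [this] at hB3'
      exact absurd hB3' (by decide)
    · left; left; right; exact ⟨hBG, h4⟩
    · left; right; exact ⟨hBG, h5⟩
    · right; exact Finset.eq_of_subset_of_card_le hBG (by omega)
  calc (UqG M p 3 G).card ≤ _ := Finset.card_le_card hsub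
    _ ≤ ((G.powersetCard 3).filter (fun T => T ∉ L) ∪ G.powersetCard 4 ∪ G.powersetCard 5).card + 1 := by
        have := Finset.card_union_le ((G.powersetCard 3).filter (fun T => T ∉ L) ∪ G.powersetCard 4 ∪ G.powersetCard 5) {G}
        rw [Finset.card_singleton] at this; exact this
    _ ≤ ((G.powersetCard 3).filter (fun T => T ∉ L) ∪ G.powersetCard 4).card + (G.powersetCard 5).card + 1 := by
        have := Finset.card_union_le ((G.powersetCard 3).filter (fun T => T ∉ L) ∪ G.powersetCard 4) (G.powersetCard 5)
        omega
    _ ≤ ((G.powersetCard 3).filter (fun T => T ∉ L)).card + (G.powersetCard 4).card + (G.powersetCard 5).card + 1 := by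
        have := Finset.card_union_le ((G.powersetCard 3).filter (fun T => T ∉ L)) (G.powersetCard 4)
        omega
    _ = 39 := by rw [card_indep_triples_triangle h', Finset.card_powersetCard, Finset.card_powersetCard, hGc]; rfl

open scoped Classical in
/-- At `t ≥ 1` the bottom sets miss `t` points; the common part of the demand bounds. -/
theorem card_UqG_le_triangle_of_le {G : Finset α} {L : Finset (Finset α)} {n t e : ℕ} (h : Triangle M G L)
    (he : M.eRk ((gr M \ G : Finset α) : Set α) = e) (het : e + t ≤ n + 4) :
    (UqG M (n + 4) 3 G).card ≤
      ((G.powersetCard 3).filter (fun T => T ∉ L) ∪ (G.powerset.filter (fun B => 4 ≤ B.card ∧ B.card + t ≤ 6))).card := by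
  obtain ⟨hGc, hLc, hL, hdeg, hdeg2, hind⟩ := h
  apply Finset.card_le_card
  intro B hB
  have hle := card_add_le_of_mem_UqG hB he het
  have hB' := hB
  unfold UqG at hB'
  rw [Finset.mem_filter, mem_Uq] at hB'
  obtain ⟨⟨_, hB3, _⟩, hBG⟩ := hB'
  have hB3' : M.eRk (B : Set α) = 3 := by exact_mod_cast hB3
  have hBc := three_le_card_of_eRk_eq_three hB3'
  simp only [Finset.mem_union, Finset.mem_filter, Finset.mem_powersetCard, Finset.mem_powerset]
  rcases Nat.lt_or_ge B.card 4 with h3 | h4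
  · left
    refine ⟨⟨hBG, by omega⟩, ?_⟩
    intro hBL
    have := (hL B hBL).2.2
    rw [this] at hB3'
    exact absurd hB3' (by decide)
  · right; exact ⟨hBG, h4, by omega⟩

open scoped Classical in
/-- Demand at `t = 1`: `≤ 38`. -/
theorem card_UqG_le_triangle_t1 {G : Finset α} {L : Finset (Finset α)} {n : ℕ} (h : Triangle M G L)
    (hK : M.eRk ((gr M \ G : Finset α) : Set α) = ((n + 3 : ℕ) : ℕ∞)) : (UqG M (n + 4) 3 G).card ≤ 38 := by
  have h1 := card_UqG_le_triangle_of_le h hK (n := n) (t := 1) (e := n + 3) (by omega)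
  have h2 := Finset.card_union_le ((G.powersetCard 3).filter (fun T => T ∉ L))
    (G.powerset.filter (fun B => 4 ≤ B.card ∧ B.card + 1 ≤ 6))
  rw [card_indep_triples_triangle h, card_filter_four_le_one h.1] at h2
  omega

open scoped Classical in
/-- Demand at `t = 2`: `≤ 32`. -/
theorem card_UqG_le_triangle_t2 {G : Finset α} {L : Finset (Finset α)} {n : ℕ} (h : Triangle M G L)
    (hK : M.eRk ((gr M \ G : Finset α) : Set α) = ((n + 2 : ℕ) : ℕ∞)) : (UqG M (n + 4) 3 G).card ≤ 32 := by
  have h1 := card_UqG_le_triangle_of_le h hK (n := n) (t := 2) (e := n + 2) (by omega)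
  have h2 := Finset.card_union_le ((G.powersetCard 3).filter (fun T => T ∉ L))
    (G.powerset.filter (fun B => 4 ≤ B.card ∧ B.card + 2 ≤ 6))
  rw [card_indep_triples_triangle h, card_filter_four_le_two h.1] at h2
  omega

open scoped Classical in
/-- Demand at `t = 3`: `≤ 14` — the independent triples whose complement is not a line (the complement of a line
is never a line: the third line would have its three points in `ℓ ∪ (G ∖ ℓ)` while meeting each in at most one). -/
theorem card_UqG_le_triangle_t3 {p : ℕ} (hc : Core M p) {G : Finset α} {L : Finset (Finset α)} {n : ℕ}
    (hG : G ∈ flatsQ M 3) (h : Triangle M G L)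
    (hK : M.eRk ((gr M \ G : Finset α) : Set α) = ((n + 1 : ℕ) : ℕ∞)) :
    (UqG M (n + 4) 3 G).card ≤ 14 := by
  have h' := h
  obtain ⟨hGc, hLc, hL, hdeg, hdeg2, hind⟩ := h
  have hsub : UqG M (n + 4) 3 G ⊆ ((G.powersetCard 3).filter (fun T => T ∉ L)) \ (L.image (fun ℓ => G \ ℓ)) := by
    intro B hB
    have hle := card_add_le_of_mem_UqG hB hK (by omega : n + 1 + 3 ≤ n + 4)
    have hge := eRk_sdiff_ge_of_mem_UqG hB hK (by omega : n + 1 + 3 ≤ n + 4)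
    have hB' := hB
    unfold UqG at hB'
    rw [Finset.mem_filter, mem_Uq] at hB'
    obtain ⟨⟨_, hB3, _⟩, hBG⟩ := hB'
    have hB3' : M.eRk (B : Set α) = 3 := by exact_mod_cast hB3
    have hBc := three_le_card_of_eRk_eq_three hB3'
    rw [Finset.mem_sdiff, Finset.mem_filter, Finset.mem_powersetCard, Finset.mem_image]
    refine ⟨⟨⟨hBG, by omega⟩, ?_⟩, ?_⟩
    · intro hBL
      have := (hL B hBL).2.2
      rw [this] at hB3'
      exact absurd hB3' (by decide)
    · rintro ⟨ℓ, hℓ, hℓB⟩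
      have : G \ B = ℓ := by rw [← hℓB, Finset.sdiff_sdiff_eq_self (hL ℓ hℓ).1]
      rw [this, (hL ℓ hℓ).2.2] at hge
      exact absurd hge (by decide)
  -- the three complements are distinct independent triples
  have himg : L.image (fun ℓ => G \ ℓ) ⊆ (G.powersetCard 3).filter (fun T => T ∉ L) := by
    intro T hT
    rw [Finset.mem_image] at hT
    obtain ⟨ℓ, hℓ, rfl⟩ := hT
    rw [Finset.mem_filter, Finset.mem_powersetCard]
    refine ⟨⟨Finset.sdiff_subset, by rw [Finset.card_sdiff_of_subset (hL ℓ hℓ).1, hGc, (hL ℓ hℓ).2.1]⟩, ?_⟩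
    intro hTL
    have hGE : G ⊆ gr M := (mem_flatsQ.1 hG).1
    have hsimple := simpleOn_of_core hc hGE
    have hlong := not_hasLongLine_of_core hc hGE
    have hne : G \ ℓ ≠ ℓ := by
      intro hh
      have h0 : (G \ ℓ) ∩ ℓ = ∅ := Finset.sdiff_inter_self ℓ G
      rw [hh, Finset.inter_self] at h0
      have := (hL ℓ hℓ).2.1
      rw [h0, Finset.card_empty] at this
      omega
    -- the third line
    obtain ⟨m, hm⟩ : ∃ m, m ∈ (L.erase ℓ).erase (G \ ℓ) := by
      apply Finset.card_pos.1
      rw [Finset.card_erase_of_mem (Finset.mem_erase.2 ⟨hne, hTL⟩), Finset.card_erase_of_mem hℓ, hLc]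
      norm_num
    rw [Finset.mem_erase, Finset.mem_erase] at hm
    obtain ⟨hmne, hmℓ, hmL⟩ := hm
    have hi1 := card_inter_le_one_of_lines hsimple hlong hGE (hL m hmL).1 (hL ℓ hℓ).1 (hL m hmL).2.1 (hL ℓ hℓ).2.1
      (hL m hmL).2.2 (hL ℓ hℓ).2.2 hmℓ
    have hi2 := card_inter_le_one_of_lines hsimple hlong hGE (hL m hmL).1 (hL _ hTL).1 (hL m hmL).2.1 (hL _ hTL).2.1
      (hL m hmL).2.2 (hL _ hTL).2.2 hmne
    have hsplit : m = (m ∩ ℓ) ∪ (m ∩ (G \ ℓ)) := by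
      rw [← Finset.inter_union_distrib_left, Finset.union_sdiff_of_subset (hL ℓ hℓ).1,
        Finset.inter_eq_left.2 (hL m hmL).1]
    have := Finset.card_union_le (m ∩ ℓ) (m ∩ (G \ ℓ))
    rw [← hsplit, (hL m hmL).2.1] at this
    omega
  have := Finset.card_le_card hsub
  rw [Finset.card_sdiff_of_subset himg, card_indep_triples_triangle h', Finset.card_image_of_injOn, hLc] at this
  · exact this
  · intro ℓ hℓ ℓ' hℓ' heq
    have := congrArg (fun S => G \ S) heq
    simp only [Finset.sdiff_sdiff_eq_self (hL ℓ hℓ).1, Finset.sdiff_sdiff_eq_self (hL ℓ' hℓ').1] at this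
    exact this

end NightThree

end PercRepro
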